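import Literature.RingTheory.KrullDimension.AffineCatenary
import Mathlib.RingTheory.Ideal.KrullsHeightTheorem
import Mathlib.RingTheory.MvPolynomial.Homogeneous
import Mathlib.RingTheory.Polynomial.Basic
import HarnessLib

/-!
# CKSV 2022, Lemma 25 in height form: lower-order perturbations of homogeneous generators do not lower the codimension

P. Chatterjee, M. Kumar, A. She, B. L. Volk, *Quadratic lower bounds for algebraic branching programs
and formulas*, comput. complex. **31** (2022) 8 (arXiv:1911.11793), §5.1, **Lemma 25** (TeX
L757–760; = **Lemma 26 / Claim 27** in the numbering of the held arXiv text `paper:arxiv-1911.11793`,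
p0017.txt:L1–30 — the TeX/journal counters run one behind): "Let `I = ⟨f_1, …, f_m⟩ ⊆ 𝔽[x]` be an
ideal generated by homogeneous polynomials. Let
`I' = ⟨f_1 + R_1, …, f_m + R_m⟩` where `R_1, …, R_m ∈ 𝔽[x]` are polynomials such that the degree
of `R_i` is smaller than the degree of `f_i`, for all `i ∈ [m]`. Then `dim 𝕍(I') ≤ dim 𝕍(I)`." The
printed proof goes through Gröbner bases (Claim 26: `LM(I) ⊆ LM(I')` for a degree order, and
`dim 𝕍(J) = dim 𝕍(LM(J))`, [CLO07, §9.3]).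

## What is proved (height form, DIFFERENT proof — disclosed)

* `CKSV2022.lemma_25_height` — for homogeneous `f_i` of degrees `e_i` and `r_i` of degree `< e_i`
  over any field `K`: every prime `P' ⊇ (f_i + r_i : i)` of `K[x_1, …, x_n]` lies above, in height,
  some prime `P ⊇ (f_i : i)`: `∃ P prime, (∀ i, f_i ∈ P) ∧ height P ≤ height P'`. Equivalently
  (`CKSV2022.lemma_25_height'`): if every prime containing all `f_i` has height `≥ c`, so does
  every prime containing all `f_i + r_i` — "`codim 𝕍(I') ≥ codim 𝕍(I)`", i.e. `dim 𝕍(I') ≤ dim 𝕍(I)`.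
* Proof (deformation to the top-degree forms, run with prime ideals and the dimension formula for
  affine domains instead of Gröbner bases). Put `B = K[t, x]` and, for a prime `Q` of `A = K[x]`,
  `ψ_Q : B → (A/Q)[T]`, `t ↦ T`, `x_i ↦ T·x̄_i`, with prime kernel `𝔓_Q`. The `t`-homogenisation
  `F_i = Σ_j t^{e_i − j} (f_i + r_i)_j` satisfies `ψ_{P'}(F_i) = T^{e_i}·(f_i + r_i)‾ = 0` and
  `F_i ≡ f_i (mod t)`. The map `Q ↦ 𝔓_Q` is strictly increasing on primes `Q ⊇ P'` (a polynomial
  `p ∈ Q' ∖ Q` homogenises to an element of `𝔓_{Q'} ∖ 𝔓_Q`), and every `𝔓_Q` lies strictly below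
  `𝔪 = (t, x)`; hence `dim B/𝔓_{P'} ≥ dim A/P' + 1` (`Order.krullDim_le_of_strictMono`). A minimal
  prime `𝔮` of `(t̄)` in the affine domain `D = B/𝔓_{P'}` has height `≤ 1` (Krull), so
  `dim D/𝔮 ≥ dim A/P'` by the dimension formula
  (`Literature.RingTheory.KrullDimension.ringKrullDim_quotient_add_height`); `D/𝔮 = B/𝔓₁` with
  `𝔓₁ ⊇ (t, F_i) ∋ f_i`, and `A/P ↠ B/𝔓₁` for `P = 𝔓₁ ∩ A ∋ f_i`, so `dim A/P ≥ dim A/P'` and, by the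
  dimension formula in `A`, `height P ≤ height P'`.

D-0026: no named facts, no definitions.

## References
* [ChatterjeeKumarSheVolk2022] — §5.1 Lemma 25 (and Lemma 24, Claim 26); [CLO07] = Cox–Little–O'Shea,
  *Ideals, Varieties, and Algorithms*, §9.3 (the printed route, not followed here).
* [Matsumura1987] H. Matsumura, *Commutative Ring Theory*, Thm 5.6 (dimension formula; tree:
  `Literature.RingTheory.KrullDimension.AffineCatenary`).
-/

noncomputable section

open MvPolynomial Finset

namespace Literature.Computability.AlgebraicComplexity

namespace CKSV2022

universe u

variable {K : Type u} [Field K]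

section Scaling

variable {S : Type*} [CommRing S] [Algebra K S] {σ : Type*}

/-- Homogeneous polynomials scale: `h(T·a_1, …, T·a_n) = T^j · h(a)` for `h` homogeneous of degree
`j`. [folklore] -/
private theorem aeval_X_mul_C_of_isHomogeneous (a : σ → S) {h : MvPolynomial σ K} {j : ℕ}
    (hh : h.IsHomogeneous j) :
    aeval (fun i => (Polynomial.X : Polynomial S) * Polynomial.C (a i)) h =
      Polynomial.X ^ j * Polynomial.C (aeval a h) := by
  classical
  conv_lhs => rw [h.as_sum]
  conv_rhs => rw [h.as_sum]
  rw [map_sum, map_sum, map_sum, Finset.mul_sum]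
  refine Finset.sum_congr rfl fun m hm => ?_
  have hdeg : m.degree = j := by
    have := hh (mem_support_iff.1 hm)
    rwa [Finsupp.degree_eq_weight_one]
  rw [aeval_monomial, aeval_monomial, Polynomial.algebraMap_apply]
  have h1 : (m.prod fun i k => ((Polynomial.X : Polynomial S) * Polynomial.C (a i)) ^ k) =
      (m.prod fun _ k => (Polynomial.X : Polynomial S) ^ k) *
        (m.prod fun i k => Polynomial.C (a i) ^ k) := by
    simp only [mul_pow]; exact Finsupp.prod_mul
  have h2 : (m.prod fun _ k => (Polynomial.X : Polynomial S) ^ k) = Polynomial.X ^ j := by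
    rw [Finsupp.prod, Finset.prod_pow_eq_pow_sum, ← hdeg, Finsupp.degree_apply]
  have h3 : (m.prod fun i k => Polynomial.C (a i) ^ k) =
      Polynomial.C (m.prod fun i k => a i ^ k) := by
    rw [map_finsuppProd]; simp only [map_pow]
  rw [h1, h2, h3, map_mul]
  ring

end Scaling

section Main

variable {n : ℕ}

/-- The substitution `t ↦ 0`, `x_i ↦ x_i` differs from the identity by a multiple of `t`.
[folklore] -/
private theorem sub_rename_kill_mem_span (G : MvPolynomial (Option (Fin n)) K) :
    G - rename some (aeval (fun o : Option (Fin n) => o.elim 0 fun i => (X i : MvPolynomial (Fin n) K)) G)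
      ∈ Ideal.span ({X none} : Set (MvPolynomial (Option (Fin n)) K)) := by
  classical
  induction G using MvPolynomial.induction_on with
  | C c => simp
  | add p q hp hq =>
    have : p + q - rename some (aeval (fun o : Option (Fin n) => o.elim 0 fun i =>
        (X i : MvPolynomial (Fin n) K)) (p + q)) =
        (p - rename some (aeval (fun o : Option (Fin n) => o.elim 0 fun i =>
          (X i : MvPolynomial (Fin n) K)) p)) +
        (q - rename some (aeval (fun o : Option (Fin n) => o.elim 0 fun i =>
          (X i : MvPolynomial (Fin n) K)) q)) := by
      rw [map_add, map_add]; ring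
    rw [this]
    exact Ideal.add_mem _ hp hq
  | mul_X p o hp =>
    cases o with
    | none =>
      have : p * X none - rename some (aeval (fun o : Option (Fin n) => o.elim 0 fun i =>
          (X i : MvPolynomial (Fin n) K)) (p * X none)) = p * X none := by
        rw [map_mul, aeval_X]; simp
      rw [this]
      exact Ideal.mul_mem_left _ _ (Ideal.subset_span rfl)
    | some i =>
      have : p * X (some i) - rename some (aeval (fun o : Option (Fin n) => o.elim 0 fun i =>
          (X i : MvPolynomial (Fin n) K)) (p * X (some i))) =
          (p - rename some (aeval (fun o : Option (Fin n) => o.elim 0 fun i =>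
            (X i : MvPolynomial (Fin n) K)) p)) * X (some i) := by
        rw [map_mul, aeval_X, map_mul]
        simp only [Option.elim_some, rename_X]
        ring
      rw [this]
      exact Ideal.mul_mem_right _ _ hp


/-! ### The deformation `ψ_Q : K[t,x] → (K[x]/Q)[T]`, `t ↦ T`, `x_i ↦ T·x̄_i` -/

/-- Components above the total degree vanish, so the component sum may be taken up to any
`e ≥ deg p`. [folklore] -/
private theorem sum_homogeneousComponent_of_le {σ : Type*} (p : MvPolynomial σ K) {e : ℕ}
    (he : p.totalDegree ≤ e) :
    ∑ j ∈ Finset.range (e + 1), homogeneousComponent j p = p := by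
  classical
  conv_rhs => rw [← sum_homogeneousComponent p]
  symm
  refine Finset.sum_subset (Finset.range_subset_range.2 (by omega)) fun j hj hj' => ?_
  rw [Finset.mem_range] at hj hj'
  exact homogeneousComponent_eq_zero j p (by omega)

/-- `ψ_Q` on a polynomial in the `x`-variables: the scaling substitution. [folklore] -/
private theorem psi_rename_some (Q : Ideal (MvPolynomial (Fin n) K)) (p : MvPolynomial (Fin n) K) :
    aeval (fun o : Option (Fin n) => o.elim Polynomial.X fun i =>
        (Polynomial.X : Polynomial (MvPolynomial (Fin n) K ⧸ Q)) *
          Polynomial.C (Ideal.Quotient.mk Q (X i))) (rename some p) =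
      aeval (fun i => (Polynomial.X : Polynomial (MvPolynomial (Fin n) K ⧸ Q)) *
        Polynomial.C (Ideal.Quotient.mk Q (X i))) p := by
  rw [aeval_rename]; rfl

/-- Reduction mod `Q` as an evaluation. [folklore] -/
private theorem aeval_mk_X (Q : Ideal (MvPolynomial (Fin n) K)) (p : MvPolynomial (Fin n) K) :
    aeval (fun i => Ideal.Quotient.mk Q (X i)) p = Ideal.Quotient.mk Q p := by
  have h := MvPolynomial.aeval_unique (Ideal.Quotient.mkₐ K Q)
  have h2 : (Ideal.Quotient.mkₐ K Q : MvPolynomial (Fin n) K →ₐ[K] _) ∘ X =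
      fun i => Ideal.Quotient.mk Q (X i) := by
    funext i; rfl
  rw [h2] at h
  rw [← h]; rfl

/-- `ψ_Q` of the `t`-homogenisation `Σ_j t^{e−j} p_j` of `p` (`deg p ≤ e`) is `T^e · p̄`. [folklore] -/
private theorem psi_homog (Q : Ideal (MvPolynomial (Fin n) K)) (p : MvPolynomial (Fin n) K) {e : ℕ}
    (he : p.totalDegree ≤ e) :
    aeval (fun o : Option (Fin n) => o.elim Polynomial.X fun i =>
        (Polynomial.X : Polynomial (MvPolynomial (Fin n) K ⧸ Q)) *
          Polynomial.C (Ideal.Quotient.mk Q (X i)))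
      (∑ j ∈ Finset.range (e + 1), X none ^ (e - j) * rename some (homogeneousComponent j p)) =
      Polynomial.X ^ e * Polynomial.C (Ideal.Quotient.mk Q p) := by
  classical
  rw [map_sum]
  have hterm : ∀ j ∈ Finset.range (e + 1),
      aeval (fun o : Option (Fin n) => o.elim Polynomial.X fun i =>
        (Polynomial.X : Polynomial (MvPolynomial (Fin n) K ⧸ Q)) *
          Polynomial.C (Ideal.Quotient.mk Q (X i)))
        (X none ^ (e - j) * rename some (homogeneousComponent j p)) =
      Polynomial.X ^ e * Polynomial.C (Ideal.Quotient.mk Q (homogeneousComponent j p)) := by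
    intro j hj
    rw [Finset.mem_range] at hj
    rw [map_mul, map_pow, aeval_X, Option.elim_none, psi_rename_some,
      aeval_X_mul_C_of_isHomogeneous _ (homogeneousComponent_isHomogeneous j p), aeval_mk_X,
      ← mul_assoc, ← pow_add, Nat.sub_add_cancel (by omega)]
  rw [Finset.sum_congr rfl hterm, ← Finset.mul_sum, ← map_sum, ← map_sum,
    sum_homogeneousComponent_of_le p he]

/-- The `t`-homogenisation of `p` is its top component modulo `t`. [folklore] -/
private theorem homog_sub_mem_span (p : MvPolynomial (Fin n) K) (e : ℕ) :
    (∑ j ∈ Finset.range (e + 1), X none ^ (e - j) * rename some (homogeneousComponent j p)) -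
        rename some (homogeneousComponent e p) ∈
      Ideal.span ({X none} : Set (MvPolynomial (Option (Fin n)) K)) := by
  classical
  rw [Finset.sum_range_succ, Nat.sub_self, pow_zero, one_mul, add_sub_cancel_right]
  refine Ideal.sum_mem _ fun j hj => ?_
  rw [Finset.mem_range] at hj
  have : (X none : MvPolynomial (Option (Fin n)) K) ^ (e - j) = X none * X none ^ (e - j - 1) := by
    rw [← pow_succ', Nat.sub_add_cancel (by omega)]
  rw [this, mul_assoc]
  exact Ideal.mul_mem_right _ _ (Ideal.subset_span rfl)

/-- `ψ_Q(G) = 0` forces `G(0, 0) = 0` (set `T = 0`). [folklore] -/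
private theorem constantCoeff_eq_zero_of_psi {Q : Ideal (MvPolynomial (Fin n) K)} (hQ : Q ≠ ⊤)
    {G : MvPolynomial (Option (Fin n)) K}
    (hG : aeval (fun o : Option (Fin n) => o.elim Polynomial.X fun i =>
        (Polynomial.X : Polynomial (MvPolynomial (Fin n) K ⧸ Q)) *
          Polynomial.C (Ideal.Quotient.mk Q (X i))) G = 0) :
    constantCoeff G = 0 := by
  haveI : Nontrivial (MvPolynomial (Fin n) K ⧸ Q) := Ideal.Quotient.nontrivial_iff.2 hQ
  have hcomp : (Polynomial.evalRingHom (0 : MvPolynomial (Fin n) K ⧸ Q)).comp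
      ((aeval (fun o : Option (Fin n) => o.elim Polynomial.X fun i =>
        (Polynomial.X : Polynomial (MvPolynomial (Fin n) K ⧸ Q)) *
          Polynomial.C (Ideal.Quotient.mk Q (X i))) :
            MvPolynomial (Option (Fin n)) K →ₐ[K] _) : MvPolynomial (Option (Fin n)) K →+* _) =
      (algebraMap K (MvPolynomial (Fin n) K ⧸ Q)).comp constantCoeff := by
    refine MvPolynomial.ringHom_ext (fun c => ?_) (fun o => ?_)
    · simp [Polynomial.algebraMap_apply]
    · cases o <;> simp
  have h := RingHom.congr_fun hcomp G
  simp only [RingHom.coe_comp, Function.comp_apply, RingHom.coe_coe, hG, map_zero] at h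
  exact (algebraMap K (MvPolynomial (Fin n) K ⧸ Q)).injective (by rw [map_zero]; exact h.symm)

/-- Monotonicity of the kernels: `ψ_{Q'} = (reduce Q → Q') ∘ ψ_Q`. [folklore] -/
private theorem psi_eq_zero_mono {Q Q' : Ideal (MvPolynomial (Fin n) K)} (hQQ' : Q ≤ Q')
    {G : MvPolynomial (Option (Fin n)) K}
    (hG : aeval (fun o : Option (Fin n) => o.elim Polynomial.X fun i =>
        (Polynomial.X : Polynomial (MvPolynomial (Fin n) K ⧸ Q)) *
          Polynomial.C (Ideal.Quotient.mk Q (X i))) G = 0) :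
    aeval (fun o : Option (Fin n) => o.elim Polynomial.X fun i =>
        (Polynomial.X : Polynomial (MvPolynomial (Fin n) K ⧸ Q')) *
          Polynomial.C (Ideal.Quotient.mk Q' (X i))) G = 0 := by
  have hcomp : (Polynomial.mapRingHom (Ideal.Quotient.factor hQQ')).comp
      ((aeval (fun o : Option (Fin n) => o.elim Polynomial.X fun i =>
        (Polynomial.X : Polynomial (MvPolynomial (Fin n) K ⧸ Q)) *
          Polynomial.C (Ideal.Quotient.mk Q (X i))) :
            MvPolynomial (Option (Fin n)) K →ₐ[K] _) : MvPolynomial (Option (Fin n)) K →+* _) =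
      ((aeval (fun o : Option (Fin n) => o.elim Polynomial.X fun i =>
        (Polynomial.X : Polynomial (MvPolynomial (Fin n) K ⧸ Q')) *
          Polynomial.C (Ideal.Quotient.mk Q' (X i))) :
            MvPolynomial (Option (Fin n)) K →ₐ[K] _) : MvPolynomial (Option (Fin n)) K →+* _) := by
    refine MvPolynomial.ringHom_ext (fun c => ?_) (fun o => ?_)
    · simp only [RingHom.coe_comp, Function.comp_apply, RingHom.coe_coe, algHom_C,
        Polynomial.algebraMap_apply, Polynomial.coe_mapRingHom, Polynomial.map_C]
      rw [← Ideal.Quotient.mk_algebraMap, Ideal.Quotient.factor_mk, Ideal.Quotient.mk_algebraMap]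
    · cases o <;> simp [Ideal.Quotient.factor_mk]
  have h := RingHom.congr_fun hcomp G
  simp only [RingHom.coe_comp, Function.comp_apply, RingHom.coe_coe, hG,
    Polynomial.coe_mapRingHom, Polynomial.map_zero] at h
  exact h.symm

/-! ### Lemma 25 in height form -/

/-- Finite dimension of an affine domain, as a natural number. [folklore] -/
private theorem exists_nat_ringKrullDim (R : Type*) [CommRing R] [IsDomain R] [Algebra K R]
    [Algebra.FiniteType K R] : ∃ s : ℕ, ringKrullDim R = s := by
  obtain ⟨s, hs, -⟩ := Literature.RingTheory.KrullDimension.exists_ringKrullDim_eq_and_trdeg_eq K R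
  exact ⟨s, hs⟩

/-- The dimension formula of an affine domain, in natural numbers. [folklore] -/
private theorem exists_nat_height (R : Type*) [CommRing R] [IsDomain R] [Algebra K R]
    [Algebra.FiniteType K R] (P : Ideal R) [P.IsPrime] {s sP : ℕ} (hs : ringKrullDim R = s)
    (hsP : ringKrullDim (R ⧸ P) = sP) : ∃ h : ℕ, P.height = h ∧ sP + h = s := by
  have hf := Literature.RingTheory.KrullDimension.ringKrullDim_quotient_add_height K P
  rw [hs, hsP] at hf
  have hle : (P.height : WithBot ℕ∞) ≤ (s : WithBot ℕ∞) := by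
    rw [← hf]
    exact le_add_of_nonneg_left (by exact_mod_cast Nat.zero_le sP)
  have hle' : P.height ≤ (s : ℕ∞) := by exact_mod_cast hle
  obtain ⟨h, hh⟩ := ENat.ne_top_iff_exists.1 (ne_top_of_le_ne_top (ENat.coe_ne_top s) hle')
  refine ⟨h, hh.symm, ?_⟩
  rw [← hh] at hf
  exact_mod_cast hf

/-- **CKSV 2022, Lemma 25, height form** ("`dim 𝕍(I') ≤ dim 𝕍(I)`" for `I = (f_i)` homogeneous and
`I' = (f_i + r_i)` with `deg r_i < deg f_i`): every prime `P' ⊇ (f_i + r_i : i)` of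
`K[x_1, …, x_n]` has height at least that of some prime `P ⊇ (f_i : i)`. Proof by deformation to
the top-degree forms (module docstring), not the printed Gröbner-basis route. Numbering: Lemma 25 /
Claim 26 of the TeX source = Lemma 26 / Claim 27 of the held arXiv text (p0017.txt:L1–30).
[cite: ChatterjeeKumarSheVolk2022, Lemma 25] -/
theorem lemma_25_height {ι : Type*} (f r : ι → MvPolynomial (Fin n) K) (e : ι → ℕ)
    (hf : ∀ i, (f i).IsHomogeneous (e i)) (hr : ∀ i, (r i).totalDegree < e i)
    (P' : Ideal (MvPolynomial (Fin n) K)) [hP' : P'.IsPrime] (hmem : ∀ i, f i + r i ∈ P') :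
    ∃ P : Ideal (MvPolynomial (Fin n) K), P.IsPrime ∧ (∀ i, f i ∈ P) ∧ P.height ≤ P'.height := by
  classical
  -- notation: `A = K[x]`, `B = K[t, x]` (`t = X none`), the kernels `𝔓 Q` of `ψ_Q`
  let A := MvPolynomial (Fin n) K
  let B := MvPolynomial (Option (Fin n)) K
  let g : (Q : Ideal A) → Option (Fin n) → Polynomial (A ⧸ Q) := fun Q o =>
    o.elim Polynomial.X fun i => (Polynomial.X : Polynomial (A ⧸ Q)) *
      Polynomial.C (Ideal.Quotient.mk Q (X i))
  let 𝔓 : Ideal A → Ideal B := fun Q => RingHom.ker (aeval (R := K) (g Q) : B →ₐ[K] _)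
  have h𝔓mem : ∀ Q G, G ∈ 𝔓 Q ↔ aeval (g Q) G = 0 := fun Q G => RingHom.mem_ker
  have h𝔓prime : ∀ Q : Ideal A, Q.IsPrime → (𝔓 Q).IsPrime := fun Q _ => RingHom.ker_isPrime _
  have h𝔓mono : ∀ Q Q' : Ideal A, Q ≤ Q' → 𝔓 Q ≤ 𝔓 Q' := fun Q Q' hQQ' G hG =>
    (h𝔓mem Q' G).2 (psi_eq_zero_mono hQQ' ((h𝔓mem Q G).1 hG))
  -- strictness witness: homogenise some `p ∈ Q' ∖ Q`
  have h𝔓strict : ∀ Q Q' : Ideal A, Q ≤ Q' → Q ≠ Q' → ∃ G, G ∈ 𝔓 Q' ∧ G ∉ 𝔓 Q := by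
    intro Q Q' hle hne
    obtain ⟨p, hpQ', hpQ⟩ : ∃ p ∈ Q', p ∉ Q :=
      (SetLike.not_le_iff_exists.1 fun h => hne (le_antisymm hle h))
    refine ⟨∑ j ∈ Finset.range (p.totalDegree + 1),
      X none ^ (p.totalDegree - j) * rename some (homogeneousComponent j p), ?_, ?_⟩
    · rw [h𝔓mem, psi_homog Q' p le_rfl, Ideal.Quotient.eq_zero_iff_mem.2 hpQ', map_zero, mul_zero]
    · rw [h𝔓mem, psi_homog Q p le_rfl]
      intro h0
      have h1 := congrArg (fun P : Polynomial (A ⧸ Q) => P.coeff p.totalDegree) h0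
      simp only [Polynomial.coeff_X_pow_mul', le_refl, if_true, Nat.sub_self,
        Polynomial.coeff_C_zero, Polynomial.coeff_zero] at h1
      exact hpQ (Ideal.Quotient.eq_zero_iff_mem.1 h1)
  -- the top ideal `𝔪 = (t, x)`
  let 𝔪 : Ideal B := RingHom.ker (constantCoeff : B →+* K)
  haveI h𝔪max : 𝔪.IsMaximal :=
    RingHom.ker_isMaximal_of_surjective constantCoeff fun a => ⟨C a, constantCoeff_C _ a⟩
  have h𝔓le𝔪 : ∀ Q : Ideal A, Q ≠ ⊤ → 𝔓 Q ≤ 𝔪 := fun Q hQ G hG =>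
    (RingHom.mem_ker).2 (constantCoeff_eq_zero_of_psi hQ ((h𝔓mem Q G).1 hG))
  have ht𝔪 : (X none : B) ∈ 𝔪 := by
    rw [RingHom.mem_ker, constantCoeff_X]
  have ht𝔓 : ∀ Q : Ideal A, Q ≠ ⊤ → (X none : B) ∉ 𝔓 Q := by
    intro Q hQ h
    haveI : Nontrivial (A ⧸ Q) := Ideal.Quotient.nontrivial_iff.2 hQ
    rw [h𝔓mem, aeval_X] at h
    exact Polynomial.X_ne_zero h
  -- the homogenised generators lie in `𝔓 P'` and reduce to `f i` modulo `t`
  let F : ι → B := fun i => ∑ j ∈ Finset.range (e i + 1),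
    X none ^ (e i - j) * rename some (homogeneousComponent j (f i + r i))
  have hdegfr : ∀ i, (f i + r i).totalDegree ≤ e i := fun i =>
    (totalDegree_add _ _).trans (max_le (hf i).totalDegree_le (hr i).le)
  have hF𝔓 : ∀ i, F i ∈ 𝔓 P' := fun i => by
    rw [h𝔓mem, psi_homog P' (f i + r i) (hdegfr i), Ideal.Quotient.eq_zero_iff_mem.2 (hmem i),
      map_zero, mul_zero]
  have hFf : ∀ i, F i - rename some (f i) ∈ Ideal.span ({X none} : Set B) := by
    intro i
    have htop : homogeneousComponent (e i) (f i + r i) = f i := by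
      rw [map_add, homogeneousComponent_eq_self (hf i), homogeneousComponent_eq_zero (e i) (r i)
        (hr i), add_zero]
    have := homog_sub_mem_span (K := K) (f i + r i) (e i)
    rwa [htop] at this
  -- `D = B / 𝔓 P'`, an affine domain of dimension `≥ dim A/P' + 1`
  haveI h𝔓P'prime : (𝔓 P').IsPrime := h𝔓prime P' hP'
  obtain ⟨sA', hsA'⟩ := exists_nat_ringKrullDim (K := K) (A ⧸ P')
  obtain ⟨sD, hsD⟩ := exists_nat_ringKrullDim (K := K) (B ⧸ 𝔓 P')
  have hPhi : sA' + 1 ≤ sD := by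
    -- the strictly increasing map `WithTop (Spec A/P') → Spec (B/𝔓 P')`
    let mkD := Ideal.Quotient.mk (𝔓 P')
    have hmkD : Function.Surjective mkD := Ideal.Quotient.mk_surjective
    have hkerD : RingHom.ker mkD = 𝔓 P' := Ideal.mk_ker
    let Ψ : WithTop (PrimeSpectrum (A ⧸ P')) → Ideal B := fun w =>
      WithTop.recTopCoe 𝔪 (fun q => 𝔓 (q.asIdeal.comap (Ideal.Quotient.mk P'))) w
    have hP'le : ∀ q : PrimeSpectrum (A ⧸ P'), P' ≤ q.asIdeal.comap (Ideal.Quotient.mk P') :=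
      fun q x hx => by
        rw [Ideal.mem_comap, Ideal.Quotient.eq_zero_iff_mem.2 hx]
        exact Ideal.zero_mem _
    have hΨprime : ∀ w, (Ψ w).IsPrime := by
      intro w
      induction w using WithTop.recTopCoe with
      | top => exact h𝔪max.isPrime
      | coe q => exact h𝔓prime _ (Ideal.comap_isPrime _ _)
    have hΨge : ∀ w, 𝔓 P' ≤ Ψ w := by
      intro w
      induction w using WithTop.recTopCoe with
      | top => exact h𝔓le𝔪 P' hP'.ne_top
      | coe q => exact h𝔓mono _ _ (hP'le q)
    have hΨlt : ∀ v w, v < w → Ψ v ≤ Ψ w ∧ ∃ G, G ∈ Ψ w ∧ G ∉ Ψ v := by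
      intro v w hvw
      induction w using WithTop.recTopCoe with
      | top =>
        induction v using WithTop.recTopCoe with
        | top => exact absurd hvw (lt_irrefl _)
        | coe q =>
          have hne : q.asIdeal.comap (Ideal.Quotient.mk P') ≠ ⊤ :=
            (Ideal.comap_isPrime _ q.asIdeal).ne_top
          exact ⟨h𝔓le𝔪 _ hne, X none, ht𝔪, ht𝔓 _ hne⟩
      | coe q' =>
        induction v using WithTop.recTopCoe with
        | top => exact absurd hvw not_top_lt
        | coe q =>
          have hqq' : q < q' := WithTop.coe_lt_coe.1 hvw
          have hle : q.asIdeal.comap (Ideal.Quotient.mk P') ≤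
              q'.asIdeal.comap (Ideal.Quotient.mk P') := Ideal.comap_mono hqq'.le
          have hne : q.asIdeal.comap (Ideal.Quotient.mk P') ≠
              q'.asIdeal.comap (Ideal.Quotient.mk P') := by
            intro h
            have := congrArg (Ideal.map (Ideal.Quotient.mk P')) h
            rw [Ideal.map_comap_of_surjective _ Ideal.Quotient.mk_surjective,
              Ideal.map_comap_of_surjective _ Ideal.Quotient.mk_surjective] at this
            exact hqq'.ne (PrimeSpectrum.ext this)
          exact ⟨h𝔓mono _ _ hle, h𝔓strict _ _ hle hne⟩
    let Φ : WithTop (PrimeSpectrum (A ⧸ P')) → PrimeSpectrum (B ⧸ 𝔓 P') := fun w =>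
      ⟨(Ψ w).map mkD, by
        haveI := hΨprime w
        exact Ideal.map_isPrime_of_surjective hmkD (by rw [hkerD]; exact hΨge w)⟩
    have hΦ : StrictMono Φ := by
      intro v w hvw
      obtain ⟨hle, G, hGw, hGv⟩ := hΨlt v w hvw
      change (Ψ v).map mkD < (Ψ w).map mkD
      refine lt_of_le_of_ne (Ideal.map_mono hle) fun heq => hGv ?_
      have h1 : mkD G ∈ (Ψ v).map mkD := by rw [heq]; exact Ideal.mem_map_of_mem _ hGw
      rw [← Ideal.mem_comap, Ideal.comap_map_of_surjective _ hmkD,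
        ← RingHom.ker_eq_comap_bot, hkerD, sup_eq_left.2 (hΨge v)] at h1
      exact h1
    have hdim := Order.krullDim_le_of_strictMono Φ hΦ
    rw [Order.krullDim_WithTop] at hdim
    change ringKrullDim (A ⧸ P') + 1 ≤ ringKrullDim (B ⧸ 𝔓 P') at hdim
    rw [hsA', hsD] at hdim
    exact_mod_cast hdim
  -- a minimal prime `𝔮` of `(t̄)` in `D`, of height `≤ 1`
  let mkD := Ideal.Quotient.mk (𝔓 P')
  have hspan : Ideal.span ((({mkD (X none)} : Finset (B ⧸ 𝔓 P')) : Set (B ⧸ 𝔓 P'))) ≤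
      𝔪.map mkD := by
    rw [Finset.coe_singleton, Ideal.span_le, Set.singleton_subset_iff]
    exact Ideal.mem_map_of_mem _ ht𝔪
  haveI h𝔪D : (𝔪.map mkD).IsPrime :=
    Ideal.map_isPrime_of_surjective Ideal.Quotient.mk_surjective
      (by rw [Ideal.mk_ker]; exact h𝔓le𝔪 P' hP'.ne_top)
  obtain ⟨𝔮, h𝔮min, -⟩ := Ideal.exists_minimalPrimes_le hspan
  haveI h𝔮prime : 𝔮.IsPrime := h𝔮min.1.1
  have h𝔮ht : 𝔮.height ≤ 1 := by
    refine (Ideal.height_le_card_of_mem_minimalPrimes_span_finset h𝔮min).trans ?_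
    rw [Finset.card_singleton]; exact le_rfl
  have ht𝔮 : mkD (X none) ∈ 𝔮 := h𝔮min.1.2 (Ideal.subset_span (by simp))
  -- the dimension formula in `D`: `dim D/𝔮 ≥ dim A/P'`
  obtain ⟨sQ, hsQ⟩ := exists_nat_ringKrullDim (K := K) ((B ⧸ 𝔓 P') ⧸ 𝔮)
  obtain ⟨hq, hhq, hsum⟩ := exists_nat_height (K := K) (B ⧸ 𝔓 P') 𝔮 hsD hsQ
  have hhq1 : hq ≤ 1 := by
    have : (hq : ℕ∞) ≤ 1 := hhq ▸ h𝔮ht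
    exact_mod_cast this
  have hsQge : sA' ≤ sQ := by omega
  -- `𝔓₁ ⊇ (t, F_i)` in `B` and `P = 𝔓₁ ∩ A ∋ f_i`
  let 𝔓₁ : Ideal B := 𝔮.comap mkD
  haveI h𝔓₁prime : 𝔓₁.IsPrime := Ideal.comap_isPrime _ _
  have h𝔓𝔓₁ : 𝔓 P' ≤ 𝔓₁ := by
    intro G hG
    rw [Ideal.mem_comap, Ideal.Quotient.eq_zero_iff_mem.2 hG]
    exact Ideal.zero_mem _
  have ht𝔓₁ : (X none : B) ∈ 𝔓₁ := ht𝔮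
  have hspan𝔓₁ : Ideal.span ({X none} : Set B) ≤ 𝔓₁ := by
    rw [Ideal.span_le, Set.singleton_subset_iff]; exact ht𝔓₁
  let ρ : A →ₐ[K] B := rename some
  let P : Ideal A := 𝔓₁.comap ρ
  haveI hPprime : P.IsPrime := Ideal.comap_isPrime _ _
  have hfP : ∀ i, f i ∈ P := by
    intro i
    rw [Ideal.mem_comap]
    have h1 : F i - (F i - rename some (f i)) ∈ 𝔓₁ :=
      Ideal.sub_mem _ (h𝔓𝔓₁ (hF𝔓 i)) (hspan𝔓₁ (hFf i))
    rwa [sub_sub_cancel] at h1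
  -- `A/P ↠ B/𝔓₁ ≅ D/𝔮`, so `dim A/P ≥ dim D/𝔮 ≥ dim A/P'`
  have hPle : P ≤ 𝔓₁.comap (ρ : A →+* B) := le_rfl
  have hsurj : Function.Surjective (Ideal.quotientMap 𝔓₁ (ρ : A →+* B) hPle) := by
    intro y
    obtain ⟨G, rfl⟩ := Ideal.Quotient.mk_surjective y
    refine ⟨Ideal.Quotient.mk P (aeval (fun o : Option (Fin n) => o.elim 0 fun i => (X i : A)) G),
      ?_⟩
    rw [Ideal.quotientMap_mk, eq_comm, Ideal.Quotient.eq]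
    exact hspan𝔓₁ (sub_rename_kill_mem_span G)
  have hequiv : ringKrullDim ((B ⧸ 𝔓 P') ⧸ 𝔮) = ringKrullDim (B ⧸ 𝔓₁) := by
    have h𝔮eq : 𝔮 = 𝔓₁.map mkD := (Ideal.map_comap_of_surjective _ Ideal.Quotient.mk_surjective 𝔮).symm
    rw [h𝔮eq]
    exact ringKrullDim_eq_of_ringEquiv (DoubleQuot.quotQuotEquivQuotOfLE h𝔓𝔓₁)
  obtain ⟨sP, hsP⟩ := exists_nat_ringKrullDim (K := K) (A ⧸ P)
  have hsPge : sQ ≤ sP := by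
    have h1 := ringKrullDim_le_of_surjective _ hsurj
    rw [← hequiv, hsQ, hsP] at h1
    exact_mod_cast h1
  -- the dimension formula in `A = K[x_1, …, x_n]`
  have hsA : ringKrullDim A = (n : ℕ) := by
    rw [MvPolynomial.ringKrullDim_of_isNoetherianRing, ringKrullDim_eq_zero_of_field K, zero_add,
      Nat.card_eq_fintype_card, Fintype.card_fin]
  obtain ⟨hP, hhP, hsumP⟩ := exists_nat_height (K := K) A P hsA hsP
  obtain ⟨hP', hhP', hsumP'⟩ := exists_nat_height (K := K) A P' hsA hsA'
  refine ⟨P, hPprime, hfP, ?_⟩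
  rw [hhP, hhP']
  exact_mod_cast (by omega : hP ≤ hP')

/-- **Lemma 25, height form, as a transfer of codimension bounds**: if every prime containing all
`f_i` has height `≥ c`, then every prime containing all `f_i + r_i` has height `≥ c`
(`deg r_i < deg f_i`, `f_i` homogeneous). [cite: ChatterjeeKumarSheVolk2022, Lemma 25] -/
theorem lemma_25_height' {ι : Type*} (f r : ι → MvPolynomial (Fin n) K) (e : ι → ℕ)
    (hf : ∀ i, (f i).IsHomogeneous (e i)) (hr : ∀ i, (r i).totalDegree < e i) {c : ℕ}
    (hc : ∀ P : Ideal (MvPolynomial (Fin n) K), P.IsPrime → (∀ i, f i ∈ P) → (c : ℕ∞) ≤ P.height)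
    (P' : Ideal (MvPolynomial (Fin n) K)) [P'.IsPrime] (hmem : ∀ i, f i + r i ∈ P') :
    (c : ℕ∞) ≤ P'.height := by
  obtain ⟨P, hP, hfP, hle⟩ := lemma_25_height f r e hf hr P' hmem
  exact (hc P hP hfP).trans hle

end Main

end CKSV2022

end Literature.Computability.AlgebraicComplexity

end
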